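import Summits.BirchSwinnertonDyer.BirchSwinnertonDyer.Theorems.ErratumRoadFiveIrreduciblePlaneIndexTwo
import Literature.NumberTheory.EllipticCurves.CofreeTorsionFiniteness
import Literature.NumberTheory.EllipticCurves.SkinnerUrban2014.GL2MainConjecture
import Literature.NumberTheory.EllipticCurves.HeegnerPoints
import Literature.NumberTheory.Automorphic.QuadraticCharacterTwist
import Summits.BirchSwinnertonDyer.Rank1Residual.X11b.TorsionCohomologyControl
import HarnessLib

/-!
# (irr_K) in element form: `A_g = K²/𝒪²` has no non-zero `Γ_K`-fixed `p`-power-torsion element when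
# `ρ̄_g` is irreducible over `Γ_ℚ`, `p` is odd and `K/ℚ` is quadratic — the stub `stub_irrK_noFixedTorsion`
# of the v3 line `erratum_chain` of crux 25505 (helper, `--supports stmt-BirchSwinnertonDyer-25505`)

Cell `bsd-stepL`, seat `bsd-stepL-imc-p1` (prover g21, 2026-08-28). Theorems only (no definition, no
named fact, no `sorry`, no instance, no notation). Eighth file of the `complete` cut of crux 25505
`ErratumThm23SigmaLe`: the hypothesis (glob) of the tree's two-variable control
(`Theorems.ErratumThm23TwoVariable.ControlAt.control_newform`, p627206) discharged from F4♯'s own binder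
`SkinnerUrban2014.IsResiduallyIrreducible Δ` — erratum Lemma 2.1, proof (p. 2): "`H⁰(K, M_g) =
H⁰(K_∞, A_g) = 0` by Shapiro's lemma and the irreducibility of `ρ̄_g|_{G_K}`"; [JSW17, §3.1 (irr_K)].
The representation theory (`IrrK.eq_zero_of_forall_apply_eq_of_index_two`) is part 1,
`ErratumRoadFiveIrreduciblePlaneIndexTwo.lean`.

## What is proved

* §2 `Cofree.exists_pow_varpi_smul_eq_zero` — `A_g` is `ϖ`-primary (`‖ϖ‖ < 1`), for the datum's
  uniformiser `Δ.ϖ`; `natCast_p_mem_span_varpi` (`p ∈ (ϖ)`), `isUnit_two_residue`, `nontrivial_residue`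
  — `2` is a unit and `1 ≠ 0` in `𝒪/(ϖ)` (`p = 0` there and `p` is odd; `ϖ` is not a unit).
* matrix bookkeeping `mulVec_sub_eq_smul_of_smul_eq`, `map_mulVec_eq_of_mulVec_sub_eq_smul`,
  `residualRep_apply_eq` (`ρ̄(σ) v = (ρ(σ) mod ϖ) v`).
* §3 `noFixedTorsion_of_isResiduallyIrreducible` — **(glob)**: for `Δ : OrdinaryNewformDatum g p ι` with
  `ρ̄ = residualRep Δ` irreducible over `Γ_ℚ`, `p ≠ 2`, and `[K:ℚ] = 2`, every `Γ_K`-fixed element of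
  `A_g = Cofree Δ.ρ` vanishes. Proof: reduce to the `ϖ`-torsion
  (`TorsionControl.forall_invariant_eq_zero_of_torsionBy`); a fixed `a = x mod 𝒪²` with `ϖ a = 0` gives
  `y = ϖ x ∈ 𝒪²` whose reduction `ȳ ∈ (𝒪/ϖ)²` is fixed by `range (absGaloisRestrict ℚ K)` (index `2`:
  `Automorphic.isOpen_range_absGaloisRestrict_and_index_eq_two`) under `ρ̄`, so `ȳ = 0` by part 1,
  `y ∈ ϖ𝒪²`, `x ∈ 𝒪²`, `a = 0`. `noFixedTorsion_of_isResiduallyIrreducible'` — the same with the v3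
  stub's binder list (`3 < p`, `IsImaginaryQuadratic K`; the `p`-power-torsion clause is automatic).

HONEST FRAMING: elementary algebra on the tree's carriers; nothing about BSD for any pair; closes: none (T7).

## References
* [Castella2018Erratum] Lemma 2.1, proof (p. 2).
* [JetchevSkinnerWan2017] §3.1, hypothesis (irr_K) (arXiv:1512.06894 p. 10).
* [EmertonPollackWeston2006] §3.1 (p. 17: `K`, `𝒪`, `π`, `ρ_f`).
-/

noncomputable section

open scoped MatrixGroups

-- D-0017: single-problem summit, the namespace repeats the problem name by design.
set_option linter.dupNamespace false
set_option autoImplicit false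

namespace Summit.BirchSwinnertonDyer.BirchSwinnertonDyer.Theorems.ErratumThm23TwoVariable.IrrK

/-! ## §2 The coefficient pair `(𝒪, K)` of a newform: `A_g` is `ϖ`-primary; `2 ∈ (𝒪/ϖ)ˣ`, `𝒪/ϖ ≠ 0` -/

section Coefficients

open Literature.NumberTheory.GaloisRepresentations Literature.NumberTheory.EllipticCurves
  Literature.NumberTheory.EllipticCurves.GreenbergSelmer Literature.NumberTheory.EllipticCurves.ModularForms

variable {M : ℕ} {k : ℤ} {g : CuspForm (CongruenceSubgroup.Gamma0 M) k} {p : ℕ} [Fact p.Prime]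
  {ι : coeffField g →+* PadicAlgCl p} (Δ : OrdinaryNewformDatum g p ι)

/-- `‖ϖ‖ < 1` for the datum's uniformiser, read on `K ⊆ ℚ̄_p`. [cite: EmertonPollackWeston2006, §3.1 (p. 17, "fix also a uniformizer π of 𝒪")] -/
theorem norm_coe_varpi_lt_one :
    ‖((Δ.ϖ : padicCoeffField ι) : PadicAlgCl p)‖ < 1 := by
  have h := Δ.norm_ϖ_lt_one
  rwa [padicCoeffIntegers.toPadicAlgCl_apply] at h

/-- **Every `x ∈ K` has `ϖ^j x ∈ 𝒪` for some `j`** (`‖ϖ‖ < 1`, so `‖ϖ‖^j ‖x‖ ≤ 1` for `j ≫ 0`).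
[cite: EmertonPollackWeston2006, §3.1 (p. 17, "`𝒪` the ring of integers of `K` … uniformizer `π`")] -/
theorem exists_pow_varpi_mul_mem (x : padicCoeffField ι) :
    ∃ (j : ℕ) (y : padicCoeffIntegers ι),
      algebraMap (padicCoeffIntegers ι) (padicCoeffField ι) y =
        algebraMap (padicCoeffIntegers ι) (padicCoeffField ι) Δ.ϖ ^ j * x := by
  have hϖ := norm_coe_varpi_lt_one Δ
  change ∃ (j : ℕ) (y : padicCoeffIntegers ι), (y : padicCoeffField ι) = (Δ.ϖ : padicCoeffField ι) ^ j * x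
  by_cases hx : ‖(x : PadicAlgCl p)‖ ≤ 1
  · exact ⟨0, ⟨x, (mem_padicCoeffIntegers_iff ι x).2 hx⟩, by rw [pow_zero, one_mul]⟩
  · have hxpos : 0 < ‖(x : PadicAlgCl p)‖ := lt_of_lt_of_le zero_lt_one (le_of_not_ge hx)
    obtain ⟨j, hj⟩ := exists_pow_lt_of_lt_one (inv_pos.2 hxpos) hϖ
    have hy : (Δ.ϖ : padicCoeffField ι) ^ j * x ∈ padicCoeffIntegers ι := by
      rw [mem_padicCoeffIntegers_iff]
      push_cast
      rw [norm_mul, norm_pow]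
      have := (mul_lt_mul_of_pos_right hj hxpos)
      rw [inv_mul_cancel₀ hxpos.ne'] at this
      exact this.le
    exact ⟨j, ⟨_, hy⟩, rfl⟩

/-- **`A_g = Kⁿ/𝒪ⁿ` is `ϖ`-primary**: every class is killed by a power of `ϖ`.
[cite: Greenberg1989, §1 p. 98 ("`A_p = V_p/T_p`")] -/
theorem Cofree.exists_pow_varpi_smul_eq_zero {G : Type*} [Group G] [TopologicalSpace G] {n : ℕ}
    (ρ : FramedRep G (padicCoeffIntegers ι) n) (a : Cofree ρ (padicCoeffField ι)) :
    ∃ j : ℕ, Δ.ϖ ^ j • a = 0 := by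
  classical
  obtain ⟨x, rfl⟩ := cofreeMk_surjective (padicCoeffField ι) ρ a
  choose j y hy using fun i ↦ exists_pow_varpi_mul_mem Δ (x i)
  refine ⟨Finset.univ.sup j, ?_⟩
  rw [← map_smul, ← LinearMap.mem_ker, ker_cofreeMk, mem_lattice_iff]
  refine ⟨fun i ↦ Δ.ϖ ^ (Finset.univ.sup j - j i) * y i, funext fun i ↦ ?_⟩
  rw [map_mul, map_pow, hy i, ← mul_assoc, ← pow_add,
    Nat.sub_add_cancel (Finset.le_sup (f := j) (Finset.mem_univ i)), Pi.smul_apply, Algebra.smul_def,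
    map_pow]

/-- `p ∈ (ϖ)`: `‖p‖ < 1`, so the uniformiser divides `p`. [cite: EmertonPollackWeston2006, §3.1 (p. 17)] -/
theorem natCast_p_mem_span_varpi :
    ((p : ℕ) : padicCoeffIntegers ι) ∈ Ideal.span {Δ.ϖ} := by
  refine Ideal.mem_span_singleton.2 (Δ.dvd_of_norm_lt_one _ ?_)
  rw [map_natCast]
  have h := PadicAlgCl.valuation_p p
  rw [PadicAlgCl.valuation_def] at h
  have hn : (‖(p : PadicAlgCl p)‖₊ : ℝ) = ((1 / (p : NNReal) : NNReal) : ℝ) := by rw [h]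
  have hp1 : (1 : ℝ) < p := by exact_mod_cast (Fact.out : p.Prime).one_lt
  have : ‖(p : PadicAlgCl p)‖ = (p : ℝ)⁻¹ := by simpa using hn
  rw [this]
  exact inv_lt_one_of_one_lt₀ hp1

/-- **`2` is a unit of `𝒪/(ϖ)`** for `p` odd: `p = 0` there and `2 · (p+1)/2 = p + 1 = 1`.
[cite: EmertonPollackWeston2006, §3.1 (p. 17, the residue field `k = 𝒪/π`)] -/
theorem isUnit_two_residue (hp : p ≠ 2) :
    IsUnit (2 : padicCoeffIntegers ι ⧸ Ideal.span {Δ.ϖ}) := by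
  have hp0 : ((p : ℕ) : padicCoeffIntegers ι ⧸ Ideal.span {Δ.ϖ}) = 0 := by
    rw [← map_natCast (Ideal.Quotient.mk (Ideal.span {Δ.ϖ})), Ideal.Quotient.eq_zero_iff_mem]
    exact natCast_p_mem_span_varpi Δ
  refine IsUnit.of_mul_eq_one (((p + 1) / 2 : ℕ) : padicCoeffIntegers ι ⧸ Ideal.span {Δ.ϖ}) ?_
  have h2 : 2 * ((p + 1) / 2) = p + 1 := Nat.two_mul_div_two_of_even (by
    rw [Nat.even_add_one, Nat.not_even_iff_odd]; exact (Fact.out : p.Prime).odd_of_ne_two hp)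
  have : ((2 * ((p + 1) / 2) : ℕ) : padicCoeffIntegers ι ⧸ Ideal.span {Δ.ϖ}) = 1 := by
    rw [h2, Nat.cast_add, hp0, zero_add, Nat.cast_one]
  rw [Nat.cast_mul] at this
  exact_mod_cast this

/-- **`𝒪/(ϖ)` is non-trivial**: `ϖ` is not a unit (`‖ϖ‖ < 1`, units of `𝒪` have norm `1`).
[cite: EmertonPollackWeston2006, §3.1 (p. 17, the residue field `k = 𝒪/π`)] -/
theorem nontrivial_residue : Nontrivial (padicCoeffIntegers ι ⧸ Ideal.span {Δ.ϖ}) := by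
  refine Ideal.Quotient.nontrivial_iff.2 fun htop ↦ ?_
  rw [Ideal.span_singleton_eq_top] at htop
  obtain ⟨u, hu⟩ := htop
  have hprod : ‖padicCoeffIntegers.toPadicAlgCl ι Δ.ϖ‖ *
      ‖padicCoeffIntegers.toPadicAlgCl ι ((u⁻¹ : (padicCoeffIntegers ι)ˣ) : padicCoeffIntegers ι)‖ = 1 := by
    rw [← norm_mul, ← map_mul, ← hu, Units.mul_inv, map_one, norm_one]
  have hle := norm_toPadicAlgCl_le_one ι ((u⁻¹ : (padicCoeffIntegers ι)ˣ) : padicCoeffIntegers ι)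
  have hlt := Δ.norm_ϖ_lt_one
  nlinarith [norm_nonneg (padicCoeffIntegers.toPadicAlgCl ι Δ.ϖ),
    norm_nonneg (padicCoeffIntegers.toPadicAlgCl ι ((u⁻¹ : (padicCoeffIntegers ι)ˣ) : padicCoeffIntegers ι))]

end Coefficients

/-! ## §3 (glob): no `Γ_K`-fixed torsion in `A_g` from the irreducibility of `ρ̄_g` -/

section MatrixAlgebra

variable {𝒪 F : Type*} [CommRing 𝒪] [CommRing F] [Algebra 𝒪 F] {n : ℕ}

/-- Matrix bookkeeping for the `ϖ`-torsion of `Fⁿ/𝒪ⁿ`: if `y = ϖ x` and `(M ⊗ F) x − x = z` with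
`y, z ∈ 𝒪ⁿ`, then `M y − y = ϖ z` in `𝒪ⁿ` (`𝒪 → F` injective). [folklore] -/
theorem mulVec_sub_eq_smul_of_smul_eq (hinj : Function.Injective (algebraMap 𝒪 F))
    (M : Matrix (Fin n) (Fin n) 𝒪) (ϖ : 𝒪) (x : Fin n → F) (y z : Fin n → 𝒪)
    (hyx : (fun i ↦ algebraMap 𝒪 F (y i)) = ϖ • x)
    (hz : (fun i ↦ algebraMap 𝒪 F (z i)) = (M.map (algebraMap 𝒪 F)).mulVec x - x) :
    M.mulVec y - y = ϖ • z := by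
  funext i
  apply hinj
  have hzi : algebraMap 𝒪 F (z i) = (M.map (algebraMap 𝒪 F)).mulVec x i - x i := congrFun hz i
  have hyi : algebraMap 𝒪 F (y i) = ϖ • x i := congrFun hyx i
  have hyx' : (⇑(algebraMap 𝒪 F) ∘ y) = ϖ • x := hyx
  rw [Pi.sub_apply, map_sub, RingHom.map_mulVec, hyx', Matrix.mulVec_smul, Pi.smul_apply, hyi,
    Pi.smul_apply, smul_eq_mul, map_mul, hzi, ← smul_sub, Algebra.smul_def]

/-- Reduction of `M y ≡ y (mod ϖ)`: if `M y − y = ϖ z` then `(M mod ϖ) (y mod ϖ) = y mod ϖ`. [folklore] -/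
theorem map_mulVec_eq_of_mulVec_sub_eq_smul (M : Matrix (Fin n) (Fin n) 𝒪) (ϖ : 𝒪) (y z : Fin n → 𝒪)
    (h : M.mulVec y - y = ϖ • z) :
    (M.map (Ideal.Quotient.mk (Ideal.span {ϖ}))).mulVec
        (fun i ↦ Ideal.Quotient.mk (Ideal.span {ϖ}) (y i)) =
      fun i ↦ Ideal.Quotient.mk (Ideal.span {ϖ}) (y i) := by
  funext i
  have e := RingHom.map_mulVec (Ideal.Quotient.mk (Ideal.span {ϖ})) M y i
  change ((M.map (Ideal.Quotient.mk (Ideal.span {ϖ}))).mulVec ((Ideal.Quotient.mk (Ideal.span {ϖ})) ∘ y)) i = _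
  rw [← e, ← sub_eq_zero, ← map_sub, show M.mulVec y i - y i = (M.mulVec y - y) i from rfl, h,
    Pi.smul_apply, smul_eq_mul, Ideal.Quotient.eq_zero_iff_mem]
  exact Ideal.mul_mem_right _ _ (Ideal.mem_span_singleton_self _)

end MatrixAlgebra

section Global

open Literature.NumberTheory.GaloisRepresentations Literature.NumberTheory.EllipticCurves
  Literature.NumberTheory.EllipticCurves.GreenbergSelmer Literature.NumberTheory.EllipticCurves.ModularForms
  Field

variable {M : ℕ} {k : ℤ} {g : CuspForm (CongruenceSubgroup.Gamma0 M) k} {p : ℕ} [Fact p.Prime]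
  {ι : coeffField g →+* PadicAlgCl p} (Δ : OrdinaryNewformDatum g p ι)
  (K : Type) [Field K] [NumberField K]

/-- Unfolding the residual representation: `ρ̄(σ) v = (ρ(σ) mod ϖ) v`. [cite: SkinnerUrban2014, §3.3.4 (p. 29, ρ̄_f)] -/
theorem residualRep_apply_eq (σ : absoluteGaloisGroup ℚ)
    (v : Fin 2 → padicCoeffIntegers ι ⧸ Ideal.span {Δ.ϖ}) :
    SkinnerUrban2014.residualRep Δ σ v =
      (((Δ.ρ σ : GL (Fin 2) (padicCoeffIntegers ι)) : Matrix (Fin 2) (Fin 2) (padicCoeffIntegers ι)).map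
        (Ideal.Quotient.mk (Ideal.span {Δ.ϖ}))).mulVec v := by
  rw [SkinnerUrban2014.residualRep_def, FramedRep.baseChangeRepresentation_apply_apply]
  rfl

/-- `ϖ ≠ 0` in `K` (else `p ∈ (ϖ) = 0` in the characteristic-zero field `K`). [cite: EmertonPollackWeston2006, §3.1 (p. 17)] -/
theorem algebraMap_varpi_ne_zero :
    algebraMap (padicCoeffIntegers ι) (padicCoeffField ι) Δ.ϖ ≠ 0 := by
  intro h
  have hϖ : Δ.ϖ = 0 := Subtype.val_injective h
  have hp0 := natCast_p_mem_span_varpi Δ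
  rw [hϖ, Ideal.span_singleton_zero, Ideal.mem_bot] at hp0
  have : ((p : ℕ) : padicCoeffField ι) = 0 := by exact_mod_cast congrArg Subtype.val hp0
  exact (Nat.cast_ne_zero.2 (Fact.out : p.Prime).ne_zero) this

set_option maxHeartbeats 400000 in
-- the matrix coercions of the framed Galois representation at `Γ_K`-elements are costly to elaborate
/-- **(glob) from (irred).** If `ρ̄_g = residualRep Δ` is irreducible over `Γ_ℚ`, `p ≠ 2` and `K/ℚ`
is quadratic, then `A_g = Cofree Δ.ρ` has no non-zero `Γ_K`-fixed element ("`H⁰(K, A_g[ϖ]) = 0` …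
by the irreducibility of `ρ̄_g|_{G_K}`", and `A_g` is `ϖ`-primary).
[cite: Castella2018Erratum, Lemma 2.1, proof (p. 2)] [cite: JetchevSkinnerWan2017, §3.1 (irr_K)] -/
theorem noFixedTorsion_of_isResiduallyIrreducible (hp : p ≠ 2) (hK : Module.finrank ℚ K = 2)
    (hirr : SkinnerUrban2014.IsResiduallyIrreducible Δ) :
    ∀ a : Cofree Δ.ρ (padicCoeffField ι),
      (∀ σ : absoluteGaloisGroup K, (Δ.cofreeRepOver K) σ a = a) → a = 0 := by
  classical
  haveI : IsSimpleOrder (Subrepresentation (SkinnerUrban2014.residualRep Δ)) := hirr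
  haveI := nontrivial_residue Δ
  have hidx := (Literature.NumberTheory.Automorphic.isOpen_range_absGaloisRestrict_and_index_eq_two ℚ K hK).2
  have hinj : Function.Injective (algebraMap (padicCoeffIntegers ι) (padicCoeffField ι)) :=
    Subtype.val_injective
  -- reduce to the `ϖ`-torsion
  refine Summit.BirchSwinnertonDyer.Rank1Residual.X11b.TorsionControl.forall_invariant_eq_zero_of_torsionBy
    (Δ.cofreeRepOver K) Δ.ϖ
    (Cofree.exists_pow_varpi_smul_eq_zero Δ Δ.ρ) fun a hϖa hfix ↦ ?_
  obtain ⟨x, rfl⟩ := cofreeMk_surjective (padicCoeffField ι) Δ.ρ a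
  -- `y = ϖ x ∈ 𝒪²`
  have hy : Δ.ϖ • x ∈ lattice 2 (padicCoeffIntegers ι) (padicCoeffField ι) := by
    rw [← ker_cofreeMk (padicCoeffField ι) Δ.ρ, LinearMap.mem_ker, map_smul]
    exact hϖa
  obtain ⟨y, hyx⟩ := (mem_lattice_iff _).1 hy
  -- the reduction `v` of `y` is fixed by `Γ_K` under `ρ̄`
  have hfixv : ∀ σ : absoluteGaloisGroup K,
      SkinnerUrban2014.residualRep Δ
          ((absGaloisRestrict ℚ K : absoluteGaloisGroup K →* absoluteGaloisGroup ℚ) σ)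
          (fun i ↦ Ideal.Quotient.mk (Ideal.span {Δ.ϖ}) (y i)) =
        fun i ↦ Ideal.Quotient.mk (Ideal.span {Δ.ϖ}) (y i) := by
    intro σ
    -- `ρ(σ) x - x ∈ 𝒪²`
    have hσ := hfix σ
    rw [ContinuousRep.restrict_apply, OrdinaryNewformDatum.cofreeRep_apply, smul_cofreeMk, ← sub_eq_zero,
      ← map_sub, ← LinearMap.mem_ker, ker_cofreeMk (padicCoeffField ι) Δ.ρ, mem_lattice_iff,
      fracRepresentation_apply_apply] at hσ
    obtain ⟨z, hz⟩ := hσ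
    -- `ρ(σ) y - y = ϖ z` in `𝒪²`, hence `ρ̄(σ) ȳ = ȳ`
    have key := mulVec_sub_eq_smul_of_smul_eq hinj _ Δ.ϖ x y z hyx hz
    have hred := map_mulVec_eq_of_mulVec_sub_eq_smul _ Δ.ϖ y z key
    have hφσ : (absGaloisRestrict ℚ K : absoluteGaloisGroup K →* absoluteGaloisGroup ℚ) σ =
        absGaloisRestrict ℚ K σ := rfl
    rw [hφσ, residualRep_apply_eq]
    exact hred
  -- §1: the reduction vanishes
  have hv0 : (fun i ↦ Ideal.Quotient.mk (Ideal.span {Δ.ϖ}) (y i)) = 0 :=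
    eq_zero_of_forall_apply_eq_of_index_two (isUnit_two_residue Δ hp) (SkinnerUrban2014.residualRep Δ)
      (absGaloisRestrict ℚ K : absoluteGaloisGroup K →* absoluteGaloisGroup ℚ) hidx _ hfixv
  -- hence `y ∈ ϖ 𝒪²`, `x ∈ 𝒪²`, `a = 0`
  have hyϖ : ∀ i, ∃ w : padicCoeffIntegers ι, y i = Δ.ϖ * w := fun i ↦ by
    have := congrFun hv0 i
    rw [Pi.zero_apply, Ideal.Quotient.eq_zero_iff_mem, Ideal.mem_span_singleton'] at this
    obtain ⟨w, hw⟩ := this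
    exact ⟨w, by rw [← hw, mul_comm]⟩
  choose w hw using hyϖ
  have hx : x ∈ lattice 2 (padicCoeffIntegers ι) (padicCoeffField ι) := by
    rw [mem_lattice_iff]
    refine ⟨w, funext fun i ↦ ?_⟩
    have hyi := congrFun hyx i
    rw [Pi.smul_apply, Algebra.smul_def, hw i, map_mul] at hyi
    exact (mul_left_cancel₀ (algebraMap_varpi_ne_zero Δ) hyi.symm).symm
  rw [← ker_cofreeMk (padicCoeffField ι) Δ.ρ, LinearMap.mem_ker] at hx
  exact hx

/-- **The stub `stub_irrK_noFixedTorsion` of line `erratum_chain` (v3), with its binder list** (`3 < p`,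
`K` imaginary quadratic, `ρ̄_g` irreducible): (glob) for `A_g`, the `p`-power-torsion clause being
automatic. [cite: Castella2018Erratum, Lemma 2.1, proof (p. 2)] [cite: JetchevSkinnerWan2017, §3.1 (irr_K)] -/
theorem noFixedTorsion_of_isResiduallyIrreducible' (hp : 3 < p) (hK : IsImaginaryQuadratic K)
    (hirr : SkinnerUrban2014.IsResiduallyIrreducible Δ) :
    ∀ a : Cofree Δ.ρ (padicCoeffField ι),
      (∀ σ : absoluteGaloisGroup K, (Δ.cofreeRepOver K) σ a = a) → (∃ j : ℕ, p ^ j • a = 0) → a = 0 :=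
  fun a ha _ ↦ noFixedTorsion_of_isResiduallyIrreducible Δ K (by omega) hK.1 hirr a ha

end Global

end Summit.BirchSwinnertonDyer.BirchSwinnertonDyer.Theorems.ErratumThm23TwoVariable.IrrK

end
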